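import Summits.QuantumFields.BalabanUV.T4Continuum.Support.TermwiseLocalReg
import Summits.QuantumFields.BalabanUV.T4Continuum.Support.TermwiseLocalThm1

/-!
# TermwiseLocalThm1Ledger — the term-wise `U(N)` ledger theorem with the background input = the tree's TYPED THEOREM 1
of [Balaban1985Variational] per run (one block of constants), realised on the lattice, with PER-LEVEL coverings:
`GoodClause ∧ Summable δ⁗` for the I-3 good class's action kind

Cell `pub-balaban`, rung (B)+1 sub-cell t4, lineage `b2b-balaban-t4-ne7-p1` (node U5 = NE7, TERM-WISE member;
generation 17), record `t4/T4-EST-NE7-P1.md` §23 (23d); companions `Support/TermwiseLocalReg`, `Support/TermwiseLocalThm1`.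
HONEST FRAMING (page 1): FIXED FINITE T⁴, rung (B)+1 = the `ε → 0` limit of unit-scale averaged expectations,
CONDITIONAL on BetaPertH and the nine spine estimates (0/9 proved); NOT infinite volume, NOT a mass gap, NOT the Clay
problem.  NE7 is NOT PRINTED in [Balaban1984PropagatorsI]–[Balaban1989LargeFieldII] and NOT proved here: every
estimate below is a HYPOTHESIS BINDER named in the statement — in particular the typed Theorem 1 `B11Thm1.Thm1At` (r2's
carrier; the printed proof is audited by the b11/pv12 lineages, NOT here), the flow window (0.31) of [Balaban1987RG1] in
`h031A`/`h031B`, and (B)/(B^μ) inside the producers of the upstream ledger kinds; nothing is hidden in a definition.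
[folklore] bookkeeping; no definitions, no cite tags; nothing printed is asserted.

WHAT IS PROVED ([folklore]).  §10 **`goodClause_summable_UN_levels_of_thm1At`** — `TermwiseLocal.goodClause_summable_UN_
levels_of_holderReg` (p204191) with its per-window printed-currency binders `hA9W`/`hB9W`/`hB9F` DISCHARGED by
`TermwiseHolder.holderReg_window_family_of_thm1At` (p204290): the two runs' backgrounds are the realised minimal-orbit
configurations `(ρ· K t τ v).cfg (U· K t τ v)`; radii `a₀ = a₁ = B₃Mc`, `a₂ = B₄Mc`.  ONE CALL.

BINDER CENSUS (every one a hypothesis; which are estimates / located / data).  Generation 9's ledger binders VERBATIM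
((T)(B-T)(R-T)(F)(F′)(S)(M)(M-B)(B-adm)(B-win)(N)(Q)(R-sc)(M-R)(R-S)(0.31)(min-A)(Q)(lift)(min-B)(act)(γ)(R-w)(W-w)) —
the upstream kinds of rows NE2–NE5/NE9 and the flow window; `hMvol`; `2 ≤ M`, `2 ≤ L`, genuine planes; and for the
ACTION kind's background:
(Thm1) `hTA hTB : ∀ K t τ v, Thm1At Cst (fam· K t τ v)` — THE TYPED THEOREM 1 at one block of constants for both runs'
  families of variational problems (run A's level-`K` problem and run B's problem at cutoff `K`, per good term and datum)
  — a HYPOTHESIS (print: [Balaban1985Variational] Thm 1 p. 279, «a₀, a₁, B₃ depend on d and L only»);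
(real) `ρA ρB` (realisations of the abstract carriers on the `(L^K)⁻¹`-lattice: DATA + the `gauge` clause = the
  SEMANTICS of r2's uninterpreted `Gauged`/`normA`/`normGradA`/`holderA`), `hPL·`, `heta·`;
(data) `VbA VbB` with (7) (`hVb·`), `UA UB` on the minimal orbits (`hU·`), `0 ≤ Mc ≤ M(ε₁)`, `ε₁ ∈ (0, a₁]`, `ε₁ ≤ 1`;
(lvl)(win) level maps `≤ K` and the window clauses (interface I-3);
(cover) `hcoverA hcoverB hcoverBf` — PER-LEVEL COVERINGS: every site of the window box of a window of level `j` (every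
  fine plaquette of run B of level `j`) lies `6`-deep in the ball of a cube of the class OF LEVEL `j` and size `≤ Mc`
  (geometry of pp. 278–279 — the class contains cubes of size `2ML^jη` at every level covering `Ω_j` with margin; NOT
  formalised: a hypothesis);
(U) `hAU hBU` — unitarity and `M·L^{K+1}`-periodicity of the realised configurations;
(repr) `hreprU hreprL` — the good term's `f₁`, `g` ARE the Wilson sums of the realised configurations (now carrying the
  (repr)-identification: the ledger's backgrounds = Theorem 1's minimisers);
(const) the smallness `20480·L²·cReg(B₃Mc,B₃Mc)·ε₁ ≤ 1`, `0 < β₀ ≤ 1`.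
OUTPUT: `GoodClause l₀ vol T A B Bad δ⁗ ∧ Summable δ⁗`, `δ⁗`'s action share
`w₀·(#planes·(cOSC(cOscReg)²ε₁²/4·windowSum (L^{−β₀})² L⁴ (jlogOf Cl K) K + C₂·windowSum L⁻² L⁴ …) + #planes·C_L·windowSum
L⁻² L⁴ …)` with the constants at `a₀ = a₁ = B₃Mc`, `a₂ = B₄Mc`.

THE WALL OF THE TERM-WISE ACTION KIND AFTER THIS FILE (row NE7): (Thm1) the typed Theorem 1 itself (HYPOTHESIS; its
proof's located leaves are the b11/pv12 skeleton's); (cover) the per-level coverings; (lvl) the level maps (U5a/U5c);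
(repr); (0.31); the upstream kinds; constants/smallness.  Nothing else of the action kind.  NOT NE7 (the nine spine
estimates are untouched), NOT summit progress.
-/

noncomputable section

open Finset MeasureTheory _root_.Filter _root_.Topology
open scoped BigOperators Matrix.Norms.L2Operator

namespace Summit.QuantumFields.BalabanUV.T4Continuum.TermwiseLocal

open Literature.MathematicalPhysics.QuantumFieldTheory.Balaban1983to89
open T4OutputRate T4RecentScale T4GoodClassBudget T4CauchySum T4Crossover T4TowerRateComposition T4TowerRateDischarge
open T4BoundaryCarrier (BFunctional atFl NE9Fl LipBackgroundFl NE5B)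
open T4TermwiseBudget T4TermwiseDeviation T4TermwiseCurrency T4TermwiseBoundary T4TermwiseResidual T4TermwiseAction
open T4TermwiseClassical T4TermwiseQuartic
open T4TermwiseInstantiate (cBCH cBCH_nonneg cSZ cSZ_nonneg)
open T4TermwiseOscillation (cOSC)
open B7Prop1Explicit B7Prop2Explicit B7Prop1Local T4TermwiseBCH T4TermwiseTorus T4TermwiseUN T4TermwiseChainUN B11
open TermwiseBackground (LocReg cReg cOscReg cReg_nonneg)
open TermwiseHolder (HolderReg Realises holderReg_window_family_of_thm1At)

/-! ## §10 The U(N) ledger theorem with the background input = the tree's TYPED THEOREM 1 per run, realised, with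
PER-LEVEL coverings -/

section Ledger
variable {n : Type*} [Fintype n] [DecidableEq n] [Nonempty n]
variable {C : T4BoundaryCarrier.Carriers} {ι : Type} [MeasurableSpace ι] {σ : Type*} [DecidableEq σ] {l₀ vol : ℝ}
  {T : ℕ → Finset σ} {Bad : ℕ → ℝ → Finset σ} {A B : ℕ → ℝ → σ → ℝ} {μ : ℕ → ℝ → σ → Measure ι}
  {fac bfac rfac : ℕ → ℝ → σ → Finset C.Dom} {Adm : Set ι} {EA : Functional C.toCarriers C.BgA}
  {EB : Functional C.toCarriers C.BgB} {BA : BFunctional C C.BgA} {BB : BFunctional C C.BgB}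
  {RA : Functional C.toCarriers C.BgA} {RB : Functional C.toCarriers C.BgB}
  {κ θ' Cr EB₀ CrR R₁ b β' w₀ : ℝ} {κ₀ : ℕ} {gA gB : ℕ → ℕ → ℝ} {gfA gfB : ℕ → ℝ} {gsA gsB : ℕ → ℕ → ℝ}
  {uA : ℕ → ι → C.BgA} {uB : ℕ → ι → C.BgB} {oneA : C.BgA} {oneB : C.BgB}
  {pend : ℕ → ℝ → σ → ι → C.Fl} {nA nB aA aB wA wB γA γB : ℕ → ℝ → σ → ι → ℝ} {qA qB : ℕ → ℝ}
  {κ₁ S : ℕ → ℝ → σ → ℕ → ℝ} {cW RW : ℕ → ℝ → σ → ℝ} {rw sw rγ zA zB c₀ : ℕ → ℝ} {Cw E a Λ Cl : ℝ}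

/-- **THE GOOD-CLASS HALF WITH `Summable δ⁗` FOR G = U(N) WILSON TERMS, THE BACKGROUND INPUT = THE TREE's TYPED
THEOREM 1 OF [Balaban1985Variational] PER RUN.**  `goodClause_summable_UN_levels_of_holderReg` with `hA9W`/`hB9W`/`hB9F`
DISCHARGED by `TermwiseHolder.holderReg_window_family_of_thm1At`: the two runs' backgrounds ARE the realised
minimal-orbit configurations `(ρ· K t τ v).cfg (U· K t τ v)` of families of variational problems `famA`, `famB` on the
lattice of spacing `(L^K)⁻¹` (`hPL·`, `heta·`), the typed `B11Thm1.Thm1At Cst` holds for every member at ONE block of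
constants (`hTA`/`hTB` — HYPOTHESES: the tree's typed Theorem 1, audited elsewhere), `ε₁ ∈ (0, a₁]`, data with (7)
(`hVbA`/`hVbB`), `U·` on the minimal orbits (`hUA`/`hUB`), one size bound `0 ≤ Mc ≤ M(ε₁)`, level maps `≤ K`, and
DISPLAYED PER-LEVEL COVERINGS (`hcoverA`/`hcoverB`: every site of the window box of a window of level `j` lies `6`-deep
in the ball of a cube of the class of level `j` and size `≤ Mc`; `hcoverBf` at run B's fine plaquettes).  The radii
are `a₀ = a₁ = B₃Mc`, `a₂ = B₄Mc`.  Every other binder BY NAME and VERBATIM: (wt)…(W-w) of generation 9, the window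
clauses, unitarity/periodicity `hAU`/`hBU` of the realised configurations, (repr) `hreprU`/`hreprL` (the good term's
`f₁`, `g` ARE the Wilson sums of the realised configurations — the (repr)-identification is now part of (repr)),
`hMvol`, `ε₁ ≤ 1`, the smallness `20480·L²·cReg(B₃Mc, B₃Mc)·ε₁ ≤ 1`, `0 < β₀ ≤ 1`, the flow window (0.31) in
`h031A`/`h031B`, the upstream kinds.  OUTPUT: the good clause with `δ⁗` (action share windowed, constants `cReg(B₃Mc,
B₃Mc)`, `cOscReg(L, B₃Mc, B₃Mc, B₄Mc)`) and `Summable δ⁗`.  No print is quoted as a fact; `Thm1At` is a hypothesis;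
NOT NE7, NOT Clay. [folklore] -/
theorem goodClause_summable_UN_levels_of_thm1At {Y YA : Type*} {Sfib : ℕ → ℝ → σ → ι → Set Y}
    {SfibA : ℕ → ℝ → σ → ι → Set YA} {g : ℕ → ℝ → σ → ι → YA → ℝ} {f₁ : ℕ → ℝ → σ → ι → Y → ℝ}
    {Q : ℕ → ℝ → σ → ι → Y → YA} {yA yB : ℕ → ℝ → σ → ι → Y} {xA : ℕ → ℝ → σ → ι → YA}
    (M L : ℕ) (hMtwo : 2 ≤ M) (hLtwo : 2 ≤ L) (planes : Finset (Fin 4 × Fin 4))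
    (hplanes : ∀ P ∈ planes, P.1 ≠ P.2)
    (famA famB : ℕ → ℝ → σ → ι → VarProblem)
    (ρA : ∀ K t τ v, Realises (famA K t τ v) 4 (Matrix n n ℂ)) (ρB : ∀ K t τ v, Realises (famB K t τ v) 4 (Matrix n n ℂ))
    (UA : ∀ K t τ v, (famA K t τ v).Cfg) (UB : ∀ K t τ v, (famB K t τ v).Cfg)
    (lvlA lvlB lvlBf : ℕ → ℝ → σ → ι → (Fin 4 × Fin 4) × B7Prop1Explicit.Site 4 → ℕ)
    (Cst : B11Thm1.Consts) {Mc ε₁ β₀ : ℝ}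
    (hUR : ∀ K, URateUpTo K EA EB (gA K) (gB K) (uA K) (uB K) Adm Cr θ' κ) (hCr : 0 ≤ Cr)
    (hθ'0 : 0 < θ') (hθ'1 : θ' < 1) (hθ'Λ : θ' ≤ Λ) (hΛ1 : 1 ≤ Λ) (hCl : 0 ≤ Cl)
    (hURB : ∀ b ∈ C.admFl, ∀ K, URateUpTo K (atFl BA b) (atFl BB b) (gA K) (gB K) (uA K) (uB K) Adm EB₀ θ' κ)
    (hEB₀ : 0 ≤ EB₀)
    (hURR : ∀ K, URateUpTo K RA RB (gA K) (gB K) (uA K) (uB K) Adm CrR θ' κ) (hCrR : 0 ≤ CrR)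
    (hfmtA : ∀ K t τ, A K t τ = ∫ v, (∏ X ∈ fac K t τ,
      Real.exp (EA (gA K) (uA K v) X - EA (gA K) oneA X)) *
        ((∏ X ∈ bfac K t τ, Real.exp (BA (gA K) (uA K v) (pend K t τ v) X)) * nA K t τ v * qA K *
          ((∏ X ∈ rfac K t τ, Real.exp (RA (gA K) (uA K v) X - RA (gA K) oneA X)) * (Real.exp (-aA K t τ v) * wA K t τ v)))
          ∂(μ K t τ))
    (hfmtB : ∀ K t τ, B K t τ = ∫ v, (∏ X ∈ fac K t τ,
      Real.exp (EB (gB K) (uB K v) X - EB (gB K) oneB X)) *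
        ((∏ X ∈ bfac K t τ, Real.exp (BB (gB K) (uB K v) (pend K t τ v) X)) * nB K t τ v * qB K *
          ((∏ X ∈ rfac K t τ, Real.exp (RB (gB K) (uB K v) X - RB (gB K) oneB X)) * (Real.exp (-aB K t τ v) * wB K t τ v)))
          ∂(μ K t τ))
    (hint : ∀ K t, |t| ≤ l₀ → ∀ τ ∈ T K \ Bad K t,
      Integrable (fun v => (∏ X ∈ fac K t τ, Real.exp (EA (gA K) (uA K v) X - EA (gA K) oneA X)) *
        ((∏ X ∈ bfac K t τ, Real.exp (BA (gA K) (uA K v) (pend K t τ v) X)) * nA K t τ v * qA K *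
          ((∏ X ∈ rfac K t τ, Real.exp (RA (gA K) (uA K v) X - RA (gA K) oneA X)) * (Real.exp (-aA K t τ v) * wA K t τ v))))
          (μ K t τ) ∧
      Integrable (fun v => (∏ X ∈ fac K t τ, Real.exp (EB (gB K) (uB K v) X - EB (gB K) oneB X)) *
        ((∏ X ∈ bfac K t τ, Real.exp (BB (gB K) (uB K v) (pend K t τ v) X)) * nB K t τ v * qB K *
          ((∏ X ∈ rfac K t τ, Real.exp (RB (gB K) (uB K v) X - RB (gB K) oneB X)) * (Real.exp (-aB K t τ v) * wB K t τ v))))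
          (μ K t τ))
    (hsc : ∀ K t, |t| ≤ l₀ → ∀ τ ∈ T K \ Bad K t, ∀ X ∈ fac K t τ, C.scale X ≤ K)
    (hoff : ∀ K t, |t| ≤ l₀ → ∀ τ ∈ T K \ Bad K t, ∀ v, v ∉ Adm →
      (∏ X ∈ fac K t τ, Real.exp (EA (gA K) (uA K v) X - EA (gA K) oneA X)) *
        ((∏ X ∈ bfac K t τ, Real.exp (BA (gA K) (uA K v) (pend K t τ v) X)) * nA K t τ v * qA K *
          ((∏ X ∈ rfac K t τ, Real.exp (RA (gA K) (uA K v) X - RA (gA K) oneA X)) * (Real.exp (-aA K t τ v) * wA K t τ v)))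
          = 0 ∧
      (∏ X ∈ fac K t τ, Real.exp (EB (gB K) (uB K v) X - EB (gB K) oneB X)) *
        ((∏ X ∈ bfac K t τ, Real.exp (BB (gB K) (uB K v) (pend K t τ v) X)) * nB K t τ v * qB K *
          ((∏ X ∈ rfac K t τ, Real.exp (RB (gB K) (uB K v) X - RB (gB K) oneB X)) * (Real.exp (-aB K t τ v) * wB K t τ v)))
          = 0)
    (hS : ∀ K t, |t| ≤ l₀ → ∀ τ ∈ T K \ Bad K t, ∀ v ∈ Adm, ∀ j ≤ K,
      |(∑ X ∈ fac K t τ with C.scale X = j,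
          (Real.log (Real.exp (EB (gB K) (uB K v) X - EB (gB K) oneB X))
            - Real.log (Real.exp (EA (gA K) (uA K v) X - EA (gA K) oneA X)))) - κ₁ K t τ j| ≤ S K t τ j)
    (hM : ∀ K t, |t| ≤ l₀ → ∀ τ ∈ T K \ Bad K t,
      Multiplicity (fac K t τ) C.scale (fun X => Real.exp (-(κ * C.d X))) Cw vol Λ K)
    (hwit : ∀ K, ∃ v₁ ∈ Adm, uA K v₁ = oneA ∧ uB K v₁ = oneB)
    (hvol : 0 ≤ vol) (hE : 0 ≤ E) (ha0 : 0 < a) (ha1 : a < 1)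
    (hSle : ∀ K t, |t| ≤ l₀ → ∀ τ ∈ T K \ Bad K t, ∀ j ≤ K, S K t τ j ≤ vol * (E * a ^ (K - j)))
    (hpend : ∀ K t, |t| ≤ l₀ → ∀ τ ∈ T K \ Bad K t, ∀ v ∈ Adm, pend K t τ v ∈ C.admFl)
    (hBwin : ∀ K t, |t| ≤ l₀ → ∀ τ ∈ T K \ Bad K t, RecentOnly (bfac K t τ) C.scale (jlogOf Cl K) K)
    (hMB : ∀ K t, |t| ≤ l₀ → ∀ τ ∈ T K \ Bad K t,
      Multiplicity (bfac K t τ) C.scale (fun X => Real.exp (-(κ * C.d X))) Cw vol Λ K)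
    (hnpos : ∀ K t, |t| ≤ l₀ → ∀ τ ∈ T K \ Bad K t, ∀ v ∈ Adm, 0 < nA K t τ v ∧ 0 < nB K t τ v)
    (hzA : ∀ K t, |t| ≤ l₀ → ∀ τ ∈ T K \ Bad K t, ∀ v ∈ Adm, |Real.log (nA K t τ v)| ≤ vol * zA K)
    (hzB : ∀ K t, |t| ≤ l₀ → ∀ τ ∈ T K \ Bad K t, ∀ v ∈ Adm, |Real.log (nB K t τ v)| ≤ vol * zB K)
    (hzAs : Summable zA) (hzBs : Summable zB)
    (hq : ∀ K, 0 < qA K ∧ 0 < qB K)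
    -- the 𝐑-kind: scales, multiplicity, one-run slice sizes, the flow window of both coupling tables
    (hrsc : ∀ K t, |t| ≤ l₀ → ∀ τ ∈ T K \ Bad K t, ∀ X ∈ rfac K t τ, C.scale X ≤ K)
    (hMR : ∀ K t, |t| ≤ l₀ → ∀ τ ∈ T K \ Bad K t,
      Multiplicity (rfac K t τ) C.scale (fun X => Real.exp (-(κ * C.d X))) Cw vol Λ K)
    (hRSA : ∀ K t, |t| ≤ l₀ → ∀ τ ∈ T K \ Bad K t, ∀ v ∈ Adm, ∀ j ≤ K,
      |∑ X ∈ rfac K t τ with C.scale X = j, (RA (gA K) (uA K v) X - RA (gA K) oneA X)| ≤ vol * (R₁ * gsA K j ^ κ₀))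
    (hRSB : ∀ K t, |t| ≤ l₀ → ∀ τ ∈ T K \ Bad K t, ∀ v ∈ Adm, ∀ j ≤ K,
      |∑ X ∈ rfac K t τ with C.scale X = j, (RB (gB K) (uB K v) X - RB (gB K) oneB X)| ≤ vol * (R₁ * gsB K j ^ κ₀))
    (hb : 0 < b) (h031A : ∀ K, Step.Discrete031 b β' K (gfA K) (gsA K))
    (h031B : ∀ K, Step.Discrete031 b β' K (gfB K) (gsB K)) (hgsA : ∀ K k, k ≤ K → 0 ≤ gsA K k)
    (hgsB : ∀ K k, k ≤ K → 0 ≤ gsB K k) (hR₁ : 0 ≤ R₁) (hκ₀ : 4 < κ₀)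
    -- the ACTION kind from ONE CLASSICAL STEP: (min-A) (Q) (lift) (min-B) (act) (U) (L) (γ)
    (hminA : ∀ K t, |t| ≤ l₀ → ∀ τ ∈ T K \ Bad K t, ∀ v ∈ Adm, IsMinOn (g K t τ v) (SfibA K t τ v) (xA K t τ v))
    (hQ : ∀ K t, |t| ≤ l₀ → ∀ τ ∈ T K \ Bad K t, ∀ v ∈ Adm, Set.MapsTo (Q K t τ v) (Sfib K t τ v) (SfibA K t τ v))
    (hlift : ∀ K t, |t| ≤ l₀ → ∀ τ ∈ T K \ Bad K t, ∀ v ∈ Adm,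
      yA K t τ v ∈ Sfib K t τ v ∧ Q K t τ v (yA K t τ v) = xA K t τ v)
    (hminB : ∀ K t, |t| ≤ l₀ → ∀ τ ∈ T K \ Bad K t, ∀ v ∈ Adm,
      yB K t τ v ∈ Sfib K t τ v ∧ IsMinOn (f₁ K t τ v) (Sfib K t τ v) (yB K t τ v))
    (hact : ∀ K t, |t| ≤ l₀ → ∀ τ ∈ T K \ Bad K t, ∀ v ∈ Adm,
      aA K t τ v = w₀ * g K t τ v (xA K t τ v) + γA K t τ v ∧
        aB K t τ v = w₀ * f₁ K t τ v (yB K t τ v) + γB K t τ v)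
    (hw₀ : 0 ≤ w₀)
    -- (U)(L) PRODUCED for G = U(N) Wilson terms from the PRINTED-CURRENCY regularity binder PER WINDOW AT THE WINDOW's
    -- LEVEL (`HolderReg` = B11 Thm 1 (9) read with B9 (3.40) at U₀ = 1, spacing (L^{lvl y})⁻¹, Hölder exponent β₀):
    -- unitarity + periodicity `hAU hBU`, `hA9W hB9W` on the window boxes, `hB9F` at run B's fine plaquettes, the
    -- window clauses `hwinA hwinB hwinBf`, the constants' signs, `ε₁ ≤ 1`, the smallness, `0 < β₀ ≤ 1`
    (hAU : ∀ K t, |t| ≤ l₀ → ∀ τ ∈ T K \ Bad K t, ∀ v ∈ Adm,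
      (∀ x κ, (ρA K t τ v).cfg (UA K t τ v) x κ ∈ unitaryUnits (Matrix n n ℂ)) ∧
        IsPeriodic (M * L ^ K * L) ((ρA K t τ v).cfg (UA K t τ v)))
    (hBU : ∀ K t, |t| ≤ l₀ → ∀ τ ∈ T K \ Bad K t, ∀ v ∈ Adm,
      (∀ x κ, (ρB K t τ v).cfg (UB K t τ v) x κ ∈ unitaryUnits (Matrix n n ℂ)) ∧
        IsPeriodic (M * L ^ K * L) ((ρB K t τ v).cfg (UB K t τ v)))
    -- THE TYPED THEOREM 1 PER RUN (one block of constants `Cst`), its data, and the PER-LEVEL coverings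
    (hPLA : ∀ K t τ v, (famA K t τ v).L = (L : ℝ)) (hetaA : ∀ K t τ v, (famA K t τ v).eta = ((L : ℝ) ^ K)⁻¹)
    (hPLB : ∀ K t τ v, (famB K t τ v).L = (L : ℝ)) (hetaB : ∀ K t τ v, (famB K t τ v).eta = ((L : ℝ) ^ K)⁻¹)
    (hTA : ∀ K t τ v, B11Thm1.Thm1At Cst (famA K t τ v)) (hTB : ∀ K t τ v, B11Thm1.Thm1At Cst (famB K t τ v))
    (hε₁a : ε₁ ≤ Cst.a₁) (VbA : ∀ K t τ v, (famA K t τ v).Bdry) (VbB : ∀ K t τ v, (famB K t τ v).Bdry)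
    (hVbA : ∀ K t τ v, (famA K t τ v).Reg7 ε₁ (VbA K t τ v)) (hVbB : ∀ K t τ v, (famB K t τ v).Reg7 ε₁ (VbB K t τ v))
    (hUA : ∀ K t τ v, (famA K t τ v).OnMinimalOrbit (Cst.B₃ * ε₁) (VbA K t τ v) (UA K t τ v))
    (hUB : ∀ K t τ v, (famB K t τ v).OnMinimalOrbit (Cst.B₃ * ε₁) (VbB K t τ v) (UB K t τ v))
    (hMc0 : 0 ≤ Mc) (hMc : Mc ≤ Cst.Mfun ε₁)
    (hlvlA : ∀ K t τ v, ∀ y ∈ pbox planes (M * L ^ K), lvlA K t τ v y ≤ K)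
    (hlvlB : ∀ K t τ v, ∀ y ∈ pbox planes (M * L ^ K), lvlB K t τ v y ≤ K)
    (hlvlBf : ∀ K t τ v, ∀ x ∈ pbox planes (M * L ^ K * L), lvlBf K t τ v x ≤ K)
    (hcoverA : ∀ K t, |t| ≤ l₀ → ∀ τ ∈ T K \ Bad K t, ∀ v ∈ Adm, ∀ y ∈ pbox planes (M * L ^ K),
      ∀ x : B7Prop1Explicit.Site 4, InBox ((L : ℤ) • y.2) (deltaHi L ((L : ℤ) • y.2) y.1.1 y.1.2) x →
        ∃ c : (famA K t τ v).Cube, (famA K t τ v).scale c = lvlA K t τ v y ∧ (famA K t τ v).sizeM c ≤ Mc ∧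
          l1 (x - (ρA K t τ v).centre c) + 6 ≤ (ρA K t τ v).radius c)
    (hcoverB : ∀ K t, |t| ≤ l₀ → ∀ τ ∈ T K \ Bad K t, ∀ v ∈ Adm, ∀ y ∈ pbox planes (M * L ^ K),
      ∀ x : B7Prop1Explicit.Site 4, InBox ((L : ℤ) • y.2) (deltaHi L ((L : ℤ) • y.2) y.1.1 y.1.2) x →
        ∃ c : (famB K t τ v).Cube, (famB K t τ v).scale c = lvlB K t τ v y ∧ (famB K t τ v).sizeM c ≤ Mc ∧
          l1 (x - (ρB K t τ v).centre c) + 6 ≤ (ρB K t τ v).radius c)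
    (hcoverBf : ∀ K t, |t| ≤ l₀ → ∀ τ ∈ T K \ Bad K t, ∀ v ∈ Adm, ∀ x ∈ pbox planes (M * L ^ K * L),
      ∀ z : B7Prop1Explicit.Site 4, z = x.2 →
        ∃ c : (famB K t τ v).Cube, (famB K t τ v).scale c = lvlBf K t τ v x ∧ (famB K t τ v).sizeM c ≤ Mc ∧
          l1 (z - (ρB K t τ v).centre c) + 6 ≤ (ρB K t τ v).radius c)
    (hwinA : ∀ K t, |t| ≤ l₀ → ∀ τ ∈ T K \ Bad K t, ∀ v ∈ Adm,
      RecentOnly (pbox planes (M * L ^ K)) (lvlA K t τ v) (jlogOf Cl K) K)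
    (hwinB : ∀ K t, |t| ≤ l₀ → ∀ τ ∈ T K \ Bad K t, ∀ v ∈ Adm,
      RecentOnly (pbox planes (M * L ^ K)) (lvlB K t τ v) (jlogOf Cl K) K)
    (hwinBf : ∀ K t, |t| ≤ l₀ → ∀ τ ∈ T K \ Bad K t, ∀ v ∈ Adm,
      RecentOnly (pbox planes (M * L ^ K * L)) (lvlBf K t τ v) (jlogOf Cl K) K)
    (hε₁ : 0 < ε₁) (hε₁1 : ε₁ ≤ 1)
    (hsmall : 20480 * (L : ℝ) ^ 2 * (cReg (Cst.B₃ * Mc) (Cst.B₃ * Mc) * ε₁) ≤ 1) (hβ₀ : 0 < β₀) (hβ₀1 : β₀ ≤ 1)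
    (hreprU : ∀ K t, |t| ≤ l₀ → ∀ τ ∈ T K \ Bad K t, ∀ v ∈ Adm,
      f₁ K t τ v (yA K t τ v) = ∑ x ∈ pbox planes (M * L ^ K * L), eN (phiU ((ρA K t τ v).cfg (UA K t τ v)) x) ∧
        g K t τ v (xA K t τ v) = ∑ y ∈ pbox planes (M * L ^ K), eN (psiU L ((ρA K t τ v).cfg (UA K t τ v)) y))
    (hreprL : ∀ K t, |t| ≤ l₀ → ∀ τ ∈ T K \ Bad K t, ∀ v ∈ Adm,
      f₁ K t τ v (yB K t τ v) = ∑ x ∈ pbox planes (M * L ^ K * L), eN (phiU ((ρB K t τ v).cfg (UB K t τ v)) x) ∧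
        g K t τ v (Q K t τ v (yB K t τ v)) = ∑ y ∈ pbox planes (M * L ^ K), eN (psiU L ((ρB K t τ v).cfg (UB K t τ v)) y))
    (hMvol : ((M : ℝ)) ^ 4 ≤ vol)
    (hγ : ∀ K t, |t| ≤ l₀ → ∀ τ ∈ T K \ Bad K t, ∀ v ∈ Adm, |γB K t τ v - γA K t τ v| ≤ vol * rγ K)
    (hrγ : Summable rγ)
    -- the residual kind after generation 8: (R-w) radii about a centre `cW`, (W-w) the WITNESS log-ratio centred
    (hwpos : ∀ K t, |t| ≤ l₀ → ∀ τ ∈ T K \ Bad K t, ∀ v ∈ Adm, 0 < wA K t τ v ∧ 0 < wB K t τ v)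
    (hRw : ∀ K t, |t| ≤ l₀ → ∀ τ ∈ T K \ Bad K t, ∀ v ∈ Adm,
      |Real.log (wB K t τ v) - Real.log (wA K t τ v) - cW K t τ| ≤ RW K t τ)
    (hRRw : ∀ K t, |t| ≤ l₀ → ∀ τ ∈ T K \ Bad K t, RW K t τ ≤ vol * rw K) (hrw : Summable rw)
    (hWw : ∀ K t, |t| ≤ l₀ → ∀ τ ∈ T K \ Bad K t, ∀ v ∈ Adm, uA K v = oneA → uB K v = oneB →
      |Real.log (wB K t τ v) - Real.log (wA K t τ v) - c₀ K| ≤ vol * sw K)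
    (hsw : Summable sw) :
    GoodClause l₀ vol T A B Bad
        (fun K => (max Cw 1 * ((E + Cr) * ∑ x ∈ antidiagonal K, min (a ^ x.2) (θ' ^ x.1 * Λ ^ x.2))
            + (EB₀ * Cw * windowSum θ' Λ (jlogOf Cl K) K + (zA K + zB K)
              + (max (2 * Cw) 1 * ((∑ p ∈ antidiagonal K, min (R₁ * gsA K p.1 ^ κ₀) (CrR * θ' ^ p.1 * Λ ^ p.2))
                  + ∑ p ∈ antidiagonal K, min (R₁ * gsB K p.1 ^ κ₀) (CrR * θ' ^ p.1 * Λ ^ p.2))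
                + (w₀ * ((planes.card : ℝ) * (cOSC L (cOscReg L (Cst.B₃ * Mc) (Cst.B₃ * Mc) (Cst.B₄ * Mc)) ^ 2 * ε₁ ^ 2 / 4
                        * windowSum (((L : ℝ) ^ (-β₀)) ^ 2) ((L : ℝ) ^ 4) (jlogOf Cl K) K
                      + (cSZ L (cReg (Cst.B₃ * Mc) (Cst.B₃ * Mc)) * cBCH L (cReg (Cst.B₃ * Mc) (Cst.B₃ * Mc)) * ε₁ ^ 3
                          + (Fintype.card n : ℝ) / 24 * (cSZ L (cReg (Cst.B₃ * Mc) (Cst.B₃ * Mc)) * ε₁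
                            + cBCH L (cReg (Cst.B₃ * Mc) (Cst.B₃ * Mc)) * ε₁ ^ 2) ^ 4)
                        * windowSum (((L : ℝ) ^ 2)⁻¹) ((L : ℝ) ^ 4) (jlogOf Cl K) K)
                    + (planes.card : ℝ)
                      * (cSZ L (cReg (Cst.B₃ * Mc) (Cst.B₃ * Mc)) * cBCH L (cReg (Cst.B₃ * Mc) (Cst.B₃ * Mc)) * ε₁ ^ 3
                        + cBCH L (cReg (Cst.B₃ * Mc) (Cst.B₃ * Mc)) ^ 2 * ε₁ ^ 4 / 2
                        + (Fintype.card n : ℝ) / 24 * (cSZ L (cReg (Cst.B₃ * Mc) (Cst.B₃ * Mc)) ^ 4 * ε₁ ^ 4))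
                      * windowSum (((L : ℝ) ^ 2)⁻¹) ((L : ℝ) ^ 4) (jlogOf Cl K) K)
                  + rγ K + rw K))))
          + (max Cw 1 * ((E + Cr) * ∑ x ∈ antidiagonal K, min (a ^ x.2) (θ' ^ x.1 * Λ ^ x.2)) + (rw K + sw K))) ∧
      Summable (fun K => (max Cw 1 * ((E + Cr) * ∑ x ∈ antidiagonal K, min (a ^ x.2) (θ' ^ x.1 * Λ ^ x.2))
            + (EB₀ * Cw * windowSum θ' Λ (jlogOf Cl K) K + (zA K + zB K)
              + (max (2 * Cw) 1 * ((∑ p ∈ antidiagonal K, min (R₁ * gsA K p.1 ^ κ₀) (CrR * θ' ^ p.1 * Λ ^ p.2))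
                  + ∑ p ∈ antidiagonal K, min (R₁ * gsB K p.1 ^ κ₀) (CrR * θ' ^ p.1 * Λ ^ p.2))
                + (w₀ * ((planes.card : ℝ) * (cOSC L (cOscReg L (Cst.B₃ * Mc) (Cst.B₃ * Mc) (Cst.B₄ * Mc)) ^ 2 * ε₁ ^ 2 / 4
                        * windowSum (((L : ℝ) ^ (-β₀)) ^ 2) ((L : ℝ) ^ 4) (jlogOf Cl K) K
                      + (cSZ L (cReg (Cst.B₃ * Mc) (Cst.B₃ * Mc)) * cBCH L (cReg (Cst.B₃ * Mc) (Cst.B₃ * Mc)) * ε₁ ^ 3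
                          + (Fintype.card n : ℝ) / 24 * (cSZ L (cReg (Cst.B₃ * Mc) (Cst.B₃ * Mc)) * ε₁
                            + cBCH L (cReg (Cst.B₃ * Mc) (Cst.B₃ * Mc)) * ε₁ ^ 2) ^ 4)
                        * windowSum (((L : ℝ) ^ 2)⁻¹) ((L : ℝ) ^ 4) (jlogOf Cl K) K)
                    + (planes.card : ℝ)
                      * (cSZ L (cReg (Cst.B₃ * Mc) (Cst.B₃ * Mc)) * cBCH L (cReg (Cst.B₃ * Mc) (Cst.B₃ * Mc)) * ε₁ ^ 3
                        + cBCH L (cReg (Cst.B₃ * Mc) (Cst.B₃ * Mc)) ^ 2 * ε₁ ^ 4 / 2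
                        + (Fintype.card n : ℝ) / 24 * (cSZ L (cReg (Cst.B₃ * Mc) (Cst.B₃ * Mc)) ^ 4 * ε₁ ^ 4))
                      * windowSum (((L : ℝ) ^ 2)⁻¹) ((L : ℝ) ^ 4) (jlogOf Cl K) K)
                  + rγ K + rw K))))
          + (max Cw 1 * ((E + Cr) * ∑ x ∈ antidiagonal K, min (a ^ x.2) (θ' ^ x.1 * Λ ^ x.2)) + (rw K + sw K))) := by
  have hL1 : 1 ≤ L := by omega
  have hB₃Mc : 0 ≤ Cst.B₃ * Mc := mul_nonneg Cst.B₃_pos.le hMc0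
  have hB₄Mc : 0 ≤ Cst.B₄ * Mc := mul_nonneg Cst.B₄_pos.le hMc0
  have hA9W := holderReg_window_family_of_thm1At (l₀ := l₀) (T := T) (Bad := Bad) (Adm := Adm) L hL1 famA ρA hPLA
    hetaA Cst hTA hε₁ hε₁a VbA hVbA UA hUA hMc (fun K => pbox planes (M * L ^ K))
    (fun y x => InBox ((L : ℤ) • y.2) (deltaHi L ((L : ℤ) • y.2) y.1.1 y.1.2) x) lvlA hlvlA hcoverA hβ₀.le hβ₀1
  have hB9W := holderReg_window_family_of_thm1At (l₀ := l₀) (T := T) (Bad := Bad) (Adm := Adm) L hL1 famB ρB hPLB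
    hetaB Cst hTB hε₁ hε₁a VbB hVbB UB hUB hMc (fun K => pbox planes (M * L ^ K))
    (fun y x => InBox ((L : ℤ) • y.2) (deltaHi L ((L : ℤ) • y.2) y.1.1 y.1.2) x) lvlB hlvlB hcoverB hβ₀.le hβ₀1
  have hB9F := holderReg_window_family_of_thm1At (l₀ := l₀) (T := T) (Bad := Bad) (Adm := Adm) L hL1 famB ρB hPLB
    hetaB Cst hTB hε₁ hε₁a VbB hVbB UB hUB hMc (fun K => pbox planes (M * L ^ K * L))
    (fun x z => z = x.2) lvlBf hlvlBf hcoverBf hβ₀.le hβ₀1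
  exact goodClause_summable_UN_levels_of_holderReg M L hMtwo hLtwo planes hplanes
    (fun K t τ v => (ρA K t τ v).cfg (UA K t τ v)) (fun K t τ v => (ρB K t τ v).cfg (UB K t τ v)) lvlA lvlB lvlBf
    hUR hCr hθ'0 hθ'1 hθ'Λ hΛ1 hCl hURB hEB₀ hURR hCrR hfmtA hfmtB hint hsc hoff hS hM hwit hvol hE ha0 ha1 hSle hpend
    hBwin hMB hnpos hzA hzB hzAs hzBs hq hrsc hMR hRSA hRSB hb h031A h031B hgsA hgsB hR₁ hκ₀ hminA hQ hlift hminB hact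
    hw₀ hAU hBU hA9W hB9W (fun K t ht τ hτ v hv x hx => hB9F K t ht τ hτ v hv x hx x.2 rfl) hwinA hwinB hwinBf hB₃Mc hB₃Mc
    hB₄Mc hε₁.le hε₁1 hsmall hβ₀ hβ₀1 hreprU hreprL hMvol hγ hrγ hwpos hRw hRRw hrw hWw hsw

end Ledger

end Summit.QuantumFields.BalabanUV.T4Continuum.TermwiseLocal
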